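import Summits.Ventures.HodgeRepro2.T5SU11ResolventSupNorm
import Summits.Ventures.HodgeRepro2.T5SU11ResolventTransformClass
import Summits.Ventures.HodgeRepro2.T5SU11SphericalTwo

/-!
# The `L¹(sinh 2t dt)` bound of the resolvent: `‖G^I_λ g‖₁ ≤ ‖g‖₁/μ` (`λ > 2`)

For `λ > 2` and a source `g` of the class at a rate `ε > 2`, Fubini on `|K_λ(t, s)| |g(s)| sinh 2s · sinh 2t` — integrable
on `(0, ∞)²` by row 520 with the test function `φ_2 ≡ 1` — and row 543's row sums `∫ |K_λ(t, s)| sinh 2t dt = 1/μ`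
(the kernel is symmetric) give

**`∫_{(0,∞)} |G^I_λ g| sinh 2t dt ≤ (∫_{(0,∞)} |g| sinh 2s ds)/μ`** (`integral_abs_greenSolI_mul_sinh_le`)

— the `L¹` dual of row 542's `L^∞` bound, with the same sharp constant `1/μ`. Nothing is claimed about (N).

Blind lane: Mathlib + the HodgeRepro2 prefix only; no sorry; axioms ⊆ {propext, Classical.choice,
Quot.sound}.
-/

namespace Summit.Ventures.HodgeRepro2.T5SU11ResolventL1Bound

open Filter Topology MeasureTheory
open Set (Ioi Ioc)
open T5SU11Cartan T5SU11SphericalFunction T5SU11SphericalTwo T5SU11SphericalDecay T5SU11RadialGreenKernel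
  T5SU11RadialGreenImproper T5SU11RadialGreenImproperDecaySource T5SU11ResolventKernelComposition
  T5SU11ResolventTransformClass T5SU11ResolventSupNorm

section measure

variable [MeasurableSpace Circle] [BorelSpace Circle]

variable {lam : ℝ} (h2 : 2 < lam) {g : ℝ → ℝ} (hg : ContinuousOn g (Ioi 0))
  {M : ℝ} (hM : ∀ s ∈ Ioc (0 : ℝ) 1, |g s| ≤ M) (hM0 : 0 ≤ M)
  {ε C s₀ : ℝ} (hε : 2 < ε) (hC : ∀ s, s₀ ≤ s → |g s| ≤ C * Real.exp (-ε * s))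

include h2 hg hM hM0 hε hC in
/-- **THE `L¹` BOUND OF THE RESOLVENT**: `∫ |G^I_λ g| sinh 2t ≤ (∫ |g| sinh 2s)/μ` for `λ > 2` and a source of rate `ε > 2`. -/
theorem integral_abs_greenSolI_mul_sinh_le :
    ∫ t in Ioi 0, |greenSolI (fun t => sph lam (hyp t)) (sphDecay lam) g t| * Real.sinh (2 * t)
      ≤ (∫ s in Ioi 0, |g s| * Real.sinh (2 * s)) / (lam * (lam - 2)) := by
  have hlam : 1 < lam := by linarith
  have hμ : 0 < lam * (lam - 2) := mul_pos (by linarith) (by linarith)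
  have hε' : 2 - lam < ε := by linarith
  -- the product integrand with the test function `φ_2 ≡ 1`
  have hF := integrable_prod_kernel (lam := lam) (lam' := 2) hlam (by norm_num) h2 hg hM hM0 hε hC
  have hFabs : Integrable (Function.uncurry fun t s => |sphGreenKernel lam t s * g s * Real.sinh (2 * s)
      * (sph 2 (hyp t) * Real.sinh (2 * t))|) ((volume.restrict (Ioi 0)).prod (volume.restrict (Ioi 0))) := hF.abs
  have hB := integrableOn_sph_mul_mul_sinh_Ioc hg hM hM0 lam
  have hA := integrableOn_sphDecay_mul_mul_sinh hlam hg hM hM0 hε' hC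
  -- the inner integrals in `s`: `|G^I_λ g(t)| sinh 2t ≤ ∫_s |F(t, s)|`
  have hinner : ∀ t, 0 < t → |greenSolI (fun t => sph lam (hyp t)) (sphDecay lam) g t| * Real.sinh (2 * t)
      ≤ ∫ s in Ioi 0, |sphGreenKernel lam t s * g s * Real.sinh (2 * s) * (sph 2 (hyp t) * Real.sinh (2 * t))| := by
    intro t ht
    have hsinh : 0 ≤ Real.sinh (2 * t) := Real.sinh_nonneg_iff.mpr (by linarith)
    have hrep := greenSolI_eq_integral_kernel hB hA ht
    have hIk : IntegrableOn (fun s => greenKernel (fun t => sph lam (hyp t)) (sphDecay lam) t s * g s * Real.sinh (2 * s))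
        (Ioi 0) := integrableOn_kernel_mul hB hA ht
    calc |greenSolI (fun t => sph lam (hyp t)) (sphDecay lam) g t| * Real.sinh (2 * t)
        = |∫ s in Ioi 0, greenKernel (fun t => sph lam (hyp t)) (sphDecay lam) t s * g s * Real.sinh (2 * s)|
          * Real.sinh (2 * t) := by rw [hrep]
      _ ≤ (∫ s in Ioi 0, |greenKernel (fun t => sph lam (hyp t)) (sphDecay lam) t s * g s * Real.sinh (2 * s)|)
          * Real.sinh (2 * t) := by
          apply mul_le_mul_of_nonneg_right _ hsinh
          have := norm_integral_le_integral_norm (μ := volume.restrict (Ioi 0))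
            (fun s => greenKernel (fun t => sph lam (hyp t)) (sphDecay lam) t s * g s * Real.sinh (2 * s))
          simpa only [Real.norm_eq_abs] using this
      _ = ∫ s in Ioi 0, |sphGreenKernel lam t s * g s * Real.sinh (2 * s) * (sph 2 (hyp t) * Real.sinh (2 * t))| := by
          rw [← MeasureTheory.integral_mul_const]
          apply setIntegral_congr_fun measurableSet_Ioi
          intro s _
          simp only [sphGreenKernel]
          rw [sph_two_hyp ht.le, one_mul, abs_mul _ (Real.sinh (2 * t)), abs_of_nonneg hsinh]
  -- the outer integrals in `t`: `∫_t |F(t, s)| = |g s| sinh 2s / μ`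
  have houter : ∀ s, 0 < s → ∫ t in Ioi 0, |sphGreenKernel lam t s * g s * Real.sinh (2 * s)
      * (sph 2 (hyp t) * Real.sinh (2 * t))| = |g s| * Real.sinh (2 * s) / (lam * (lam - 2)) := by
    intro s hs
    have hsinh : 0 ≤ Real.sinh (2 * s) := Real.sinh_nonneg_iff.mpr (by linarith)
    have e : ∀ t, 0 < t → |sphGreenKernel lam t s * g s * Real.sinh (2 * s) * (sph 2 (hyp t) * Real.sinh (2 * t))|
        = |sphGreenKernel lam s t| * Real.sinh (2 * t) * (|g s| * Real.sinh (2 * s)) := by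
      intro t ht
      have hsinh' : 0 ≤ Real.sinh (2 * t) := Real.sinh_nonneg_iff.mpr (by linarith)
      rw [sph_two_hyp ht.le, one_mul, abs_mul, abs_mul, abs_mul, abs_of_nonneg hsinh, abs_of_nonneg hsinh',
        sphGreenKernel_symm lam t s]
      ring
    rw [setIntegral_congr_fun measurableSet_Ioi (fun t ht => e t ht), MeasureTheory.integral_mul_const,
      integral_abs_sphGreenKernel_mul_sinh h2 hs]
    ring
  -- assemble: `∫_t |G g| sinh ≤ ∫_t ∫_s |F| = ∫_s ∫_t |F| = ∫_s |g| sinh / μ`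
  have hswap := integral_integral_swap hFabs
  have hleft : ∫ t in Ioi 0, |greenSolI (fun t => sph lam (hyp t)) (sphDecay lam) g t| * Real.sinh (2 * t)
      ≤ ∫ t in Ioi 0, ∫ s in Ioi 0, |sphGreenKernel lam t s * g s * Real.sinh (2 * s)
        * (sph 2 (hyp t) * Real.sinh (2 * t))| := by
    refine integral_mono_of_nonneg ?_ hFabs.integral_prod_left ?_
    · exact ae_restrict_of_forall_mem measurableSet_Ioi (fun t ht =>
        mul_nonneg (abs_nonneg _) (Real.sinh_nonneg_iff.mpr (by linarith [Set.mem_Ioi.mp ht])))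
    · exact ae_restrict_of_forall_mem measurableSet_Ioi (fun t ht => hinner t ht)
  have hright : ∫ s in Ioi 0, ∫ t in Ioi 0, |sphGreenKernel lam t s * g s * Real.sinh (2 * s)
        * (sph 2 (hyp t) * Real.sinh (2 * t))|
      = (∫ s in Ioi 0, |g s| * Real.sinh (2 * s)) / (lam * (lam - 2)) := by
    rw [← MeasureTheory.integral_div]
    exact setIntegral_congr_fun measurableSet_Ioi (fun s hs => houter s hs)
  calc ∫ t in Ioi 0, |greenSolI (fun t => sph lam (hyp t)) (sphDecay lam) g t| * Real.sinh (2 * t)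
      ≤ ∫ t in Ioi 0, ∫ s in Ioi 0, |sphGreenKernel lam t s * g s * Real.sinh (2 * s)
          * (sph 2 (hyp t) * Real.sinh (2 * t))| := hleft
    _ = ∫ s in Ioi 0, ∫ t in Ioi 0, |sphGreenKernel lam t s * g s * Real.sinh (2 * s)
          * (sph 2 (hyp t) * Real.sinh (2 * t))| := hswap
    _ = (∫ s in Ioi 0, |g s| * Real.sinh (2 * s)) / (lam * (lam - 2)) := hright

end measure

end Summit.Ventures.HodgeRepro2.T5SU11ResolventL1Bound
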